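import Summits.QuantumFields.BalabanUV.T4Continuum.Support.DirichletCutoutNearDecay
import Summits.QuantumFields.BalabanUV.T4Continuum.Support.DirichletCutoutBudgetConstants

/-!
# `BalabanUV.T4Continuum.Support.DirichletCutoutBudgetScale` — NE2 (node U1a) formalisation swarm, sub-row `T4-U1a.S-NE2-D1-DIRICHLET°`, supplier item
# «Δ1-SKELETON» (file 21): THE BUDGET AT ONE DYADIC SCALE (`d = 3`) — choosing the cut-out scales `R = ⌊n/2^{J+4}⌋`, `R′ = 2R + 2`, `m = 2R + 3`
# in file 18's budget gives, for every `J` with `2^{J+6} ≤ n`, every block set `S`, axis `μ` and datum `w`,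
# `‖∂_μᴴ∂_μ v‖² ≤ (Kfar·2^{19}·n·(2^J)³ + Knear·n²·θ_3^J)·‖w‖²` with constants depending on `a′` only
# (unit b2b-balaban-t4-ne2-formalise-leaf-08, gen 7, file 21)

HONEST FRAMING.  Rung (B)+1 estimate at MODEL level (U = 1 scalar `Δ′ = Δ + a′Π′`, finite torus, `d = 3`); [folklore]; NE2 (U1a) is NOT proved
by this file; spine PROVED 0/9 unchanged; NOT `d = 4`, NOT infinite volume, NOT the mass gap, NOT Clay.  HONEST DEPENDENCY (verbatim):
«continuum YM on T⁴ ⇐ BetaPertH ∧ nine spine estimates (0/9 proved); BetaPertH ⇐ (D1) ∧ (D4) ∧ CAP+tail; G-an2-4 gates asym, D1 and NE2/3/4.»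

WHAT THIS FILE PROVES (0 sorry; files 18, 20 BY NAME).  `Knear` (data), `Knear_nonneg`, the integer bookkeeping `scale_facts`, and the END
**`nsq_sdiffH_sdiff_solExt_le_dyadic`**.

ABSOLUTE RULE (cell, verbatim): «No internally-minted statement may enter as a cited fact. Every hypothesis is either kernel-proved in
this package or a verbatim quotation of a PUBLISHED theorem with page reference. The manuscript(s) under audit are NOT citable for
their own disputed steps — they are the thing under adjudication; programme-internal (2001/route/tribunal) claims are never citable.»
[folklore]; one data definition; no `def … : Prop` fact.  NOT CLAIMED: the tower rate (next file), `d = 4`, NE2, NE3.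
-/

noncomputable section

open scoped BigOperators ComplexConjugate Matrix
open Finset

namespace Summit.QuantumFields.BalabanUV.T4Continuum.DirichletCutoutBudgetScale

open Literature.MathematicalPhysics.QuantumFieldTheory.Balaban1983to89.B5Prop11Plancherel (Tor fine)
open Literature.MathematicalPhysics.QuantumFieldTheory.Balaban1983to89.B5Action121 (sdiff)
open Literature.MathematicalPhysics.QuantumFieldTheory.Balaban1983to89.B5Prop11Lower (nsq nsq_nonneg)
open Summit.QuantumFields.BalabanUV.Beta.GAN24.DirichletBoxTrace (blockReg)
open Summit.QuantumFields.BalabanUV.Beta.GAN24.DirichletBoxCompression (solExt)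
open Summit.QuantumFields.BalabanUV.T4Continuum.ScalarAveragedPropagator (gammaPs gammaPs_pos)
open Summit.QuantumFields.BalabanUV.T4Continuum.DirichletHoleFilling (theta theta_lt_one)
open Summit.QuantumFields.BalabanUV.T4Continuum.DirichletCornerCutoutEta (ell1C)
open Summit.QuantumFields.BalabanUV.T4Continuum.DirichletCutoutFarPart (A1 A2)
open Summit.QuantumFields.BalabanUV.T4Continuum.DirichletCutoutNearDecay (Cdec Cdec_nonneg nsq_sdiffH_sdiff_solExt_le_budget)
open Summit.QuantumFields.BalabanUV.T4Continuum.DirichletCutoutBudgetConstants (c1 c1_nonneg Kfar Kfar_nonneg A1_mul_A2_le A2_nonneg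
  ell1C_sq_window_le)

/-- the near-part constant `Knear = 16·Cdec·(1 + d(1+2^d)(28c₁d²)²)`. [folklore] -/
def Knear (d : ℕ) (a' : ℝ) : ℝ := 16 * Cdec d a' * (1 + d * (1 + 2 ^ d) * (28 * c1 d * d ^ 2) ^ 2)

/-- `Knear ≥ 0`. [folklore] -/
theorem Knear_nonneg (d : ℕ) (a' : ℝ) : 0 ≤ Knear d a' := by
  have := Cdec_nonneg d a'; have := c1_nonneg d; unfold Knear; positivity

/-- **integer bookkeeping of the dyadic choice** `R = ⌊n/2^{J+4}⌋` under `2^{J+6} ≤ n`: with `Q = 2^J`, `T = Q·R`,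
`16T ≤ n`, `n + 32Q ≤ 32T`, `4 ≤ R`, `R ≤ T`, `3Q ≤ T`. [folklore] -/
theorem scale_facts {n J : ℕ} (hJ : 2 ^ (J + 6) ≤ n) :
    16 * (2 ^ J * (n / 2 ^ (J + 4))) ≤ n ∧ n + 32 * 2 ^ J ≤ 32 * (2 ^ J * (n / 2 ^ (J + 4))) ∧ 4 ≤ n / 2 ^ (J + 4)
      ∧ n / 2 ^ (J + 4) ≤ 2 ^ J * (n / 2 ^ (J + 4)) ∧ 3 * 2 ^ J ≤ 2 ^ J * (n / 2 ^ (J + 4)) := by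
  set Q := 2 ^ J with hQ
  set R := n / 2 ^ (J + 4) with hR
  have hQpos : 0 < Q := by rw [hQ]; positivity
  have hP : 2 ^ (J + 4) = 16 * Q := by rw [hQ, pow_add]; norm_num; ring
  have hP6 : 2 ^ (J + 6) = 64 * Q := by rw [hQ, pow_add]; norm_num; ring
  have h1 : R * 2 ^ (J + 4) ≤ n := Nat.div_mul_le_self n _
  have h2 : n < R * 2 ^ (J + 4) + 2 ^ (J + 4) := Nat.lt_div_mul_add (by positivity)
  rw [hP] at h1 h2
  rw [hP6] at hJ
  have hT : R * (16 * Q) = 16 * (Q * R) := by ring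
  rw [hT] at h1 h2
  have hR4 : 4 ≤ R := by
    by_contra h
    have h3 : Q * R ≤ Q * 3 := Nat.mul_le_mul_left Q (by omega)
    omega
  have hRT : R ≤ Q * R := Nat.le_mul_of_pos_left R hQpos
  have h3Q : 3 * Q ≤ Q * R := by nlinarith
  refine ⟨by omega, by omega, hR4, hRT, h3Q⟩

section Dyadic

variable {d : ℕ} {n : ℕ} [NeZero n] {M : Fin d → ℕ} [hM : ∀ μ, NeZero (M μ)]

/-- **THE SECOND-DIFFERENCE BUDGET AT ONE DYADIC SCALE (`d = 3`).**  For every block set `S`, axis `μ`, datum `w`, and every `J` with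
`2^{J+6} ≤ n`: `‖∂_μᴴ∂_μ v‖² ≤ (Kfar·2^{19}·n·(2^J)³ + Knear·n²·θ_d^J)·‖w‖²`, `v = solExt n M a′ (blockReg S) w`. [folklore] -/
theorem nsq_sdiffH_sdiff_solExt_le_dyadic (hd : d = 3) {a' : ℝ} (ha' : 0 < a') (S : Tor M → Prop) [DecidablePred S] (μ : Fin d)
    {J : ℕ} (hJ : 2 ^ (J + 6) ≤ n) (w : {x // blockReg n M S x} → ℂ) :
    nsq ((sdiff (fine n M) (n : ℂ) μ)ᴴ *ᵥ (sdiff (fine n M) (n : ℂ) μ *ᵥ solExt n M a' (blockReg n M S) w))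
      ≤ (Kfar d a' * 2 ^ 19 * n * ((2 : ℝ) ^ J) ^ 3 + Knear d a' * (n : ℝ) ^ 2 * theta d ^ J) * nsq w := by
  obtain ⟨h16, h32, hR4, hRT, h3Q⟩ := scale_facts hJ
  -- the scales (`R = n / 2^(J+4)`, `R' = 2R + 2`, `m = 2R + 3`)
  have hR2 : 2 ≤ n / 2 ^ (J + 4) := by omega
  have hn4 : 4 * (n / 2 ^ (J + 4)) ≤ n := by omega
  have hRR : 2 * (n / 2 ^ (J + 4)) + 2 ≤ 2 * (n / 2 ^ (J + 4)) + 2 := le_rfl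
  have hn : 2 * (2 * (n / 2 ^ (J + 4)) + 2 + n / 2 ^ (J + 4)) ≤ n := by omega
  have hr : 2 * (n / 2 ^ (J + 4)) + 2 + n / 2 ^ (J + 4) + 4 ≤ 2 * (2 * (n / 2 ^ (J + 4)) + 3) := by omega
  have h4m : 4 * (2 * (n / 2 ^ (J + 4)) + 3) ≤ n := by omega
  have hn₀ : 4 * (2 * (n / 2 ^ (J + 4)) + 3) = (8 * (n / 2 ^ (J + 4)) + 11) + 1 := by omega
  have hmQ : 2 ^ J * (2 * (n / 2 ^ (J + 4)) + 3) = 2 * (2 ^ J * (n / 2 ^ (J + 4))) + 3 * 2 ^ J := by ring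
  have hnn : 4 * (2 ^ J * (2 * (n / 2 ^ (J + 4)) + 3)) = (4 * (2 ^ J * (2 * (n / 2 ^ (J + 4)) + 3)) - 1) + 1 := by
    rw [hmQ]; omega
  have hK : 2 * (2 ^ J * (2 * (n / 2 ^ (J + 4)) + 3)) ≤ n := by rw [hmQ]; omega
  have hN' : ∀ ν, (4 * (2 ^ J * (2 * (n / 2 ^ (J + 4)) + 3)) - 1) + 1 ≤ fine n M ν := by
    intro ν
    have h1 : 1 ≤ M ν := Nat.one_le_iff_ne_zero.mpr (NeZero.ne _)
    have hle : n ≤ fine n M ν := by unfold fine; exact Nat.le_mul_of_pos_right n h1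
    rw [hmQ]
    omega
  have hbud := nsq_sdiffH_sdiff_solExt_le_budget hd hR2 hn4 hRR hn ha' hr h4m hn₀ J hnn hK hN' (S := S) (μ := μ) w
  refine hbud.trans (mul_le_mul_of_nonneg_right ?_ (nsq_nonneg w))
  set Q := 2 ^ J with hQ
  set R := n / 2 ^ (J + 4) with hR
  -- the far constant
  have hnpos : (0 : ℝ) < n := by exact_mod_cast Nat.pos_of_ne_zero (NeZero.ne n)
  have hRn : R - 1 ≤ n := by omega
  have hfar := A1_mul_A2_le hR2 hRn (d := d) (a' := a')
  have hY : (n : ℝ) / ((R : ℝ) - 1) ≤ 32 * (Q : ℝ) := by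
    have hR1 : (0 : ℝ) < (R : ℝ) - 1 := by
      have : (4 : ℝ) ≤ R := by exact_mod_cast hR4
      linarith
    rw [div_le_iff₀ hR1]
    have h32' : (n : ℝ) + 32 * (Q : ℝ) ≤ 32 * ((Q : ℝ) * R) := by exact_mod_cast h32
    nlinarith
  have hY0 : 0 ≤ (n : ℝ) / ((R : ℝ) - 1) := by
    have : (4 : ℝ) ≤ R := by exact_mod_cast hR4
    exact div_nonneg hnpos.le (by linarith)
  have hQ2 : ((Q : ℕ) : ℝ) = (2 : ℝ) ^ J := by rw [hQ]; push_cast; ring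
  have hY3 : ((n : ℝ) / ((R : ℝ) - 1)) ^ 3 ≤ 2 ^ 15 * ((2 : ℝ) ^ J) ^ 3 := by
    have := pow_le_pow_left₀ hY0 hY 3
    rw [hQ2] at this
    nlinarith
  have hKf := Kfar_nonneg d a'
  have h1 : 16 * (n : ℝ) * A1 d a' n R * A2 d a' n R ≤ Kfar d a' * 2 ^ 19 * n * ((2 : ℝ) ^ J) ^ 3 := by
    have := mul_le_mul_of_nonneg_left (hfar.trans (mul_le_mul_of_nonneg_left hY3 hKf)) (by positivity : (0 : ℝ) ≤ 16 * n)
    nlinarith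
  -- the near constant
  have hθ : 0 ≤ theta d ^ J := pow_nonneg (by linarith [(theta_lt_one d).1]) J
  have hC := Cdec_nonneg d a'
  have hwin := ell1C_sq_window_le hR2 d
  have hc := c1_nonneg d
  have h2 : 16 * (n : ℝ) ^ 2 * (theta d ^ J * Cdec d a')
        * (1 + d * (1 + 2 ^ d) * ell1C d R ^ 2 * (((8 * R + 11 : ℕ) : ℝ) * ((8 * R + 11 : ℕ) + 1)))
      ≤ Knear d a' * (n : ℝ) ^ 2 * theta d ^ J := by
    have hd0 : (0 : ℝ) ≤ d * (1 + 2 ^ d) := by positivity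
    have hin : 1 + d * (1 + 2 ^ d) * ell1C d R ^ 2 * (((8 * R + 11 : ℕ) : ℝ) * ((8 * R + 11 : ℕ) + 1))
        ≤ 1 + d * (1 + 2 ^ d) * (28 * c1 d * d ^ 2) ^ 2 := by
      have := mul_le_mul_of_nonneg_left hwin hd0
      nlinarith
    unfold Knear
    have := mul_le_mul_of_nonneg_left hin (by positivity : (0 : ℝ) ≤ 16 * (n : ℝ) ^ 2 * (theta d ^ J * Cdec d a'))
    nlinarith
  linarith

end Dyadic

end Summit.QuantumFields.BalabanUV.T4Continuum.DirichletCutoutBudgetScale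

end
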